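import Literature.NumberTheory.PAdicHodge.AinfRamifiedDivisionLift
import Literature.NumberTheory.PAdicHodge.AinfRamifiedOmegaPeriodHom
import HarnessLib

/-!
# Brick K1 over the ramified base `𝒪_D = ℤ_p[ϖ]`: the integrating element `b_ω ∈ Fil¹B_dR⁺` of the Kummer cocycle of a
# division sequence with a `Γ_F`-fixed lift of its base point, and the supply of fixed lifts for `𝒪_D`-rational points

Topic `Literature/NumberTheory/PAdicHodge`; namespace `Literature.NumberTheory.PAdicHodge.AinfRamTop`. The ramified twin
(`A_inf(𝒪) = 𝔸_inf(F) ⊗ 𝒪_D`, `W` a Weierstrass equation over `CoeffDisc D = 𝒪_D`, Tate module `TatePtO F (W ⊗_ψ 𝒪_F) p`) of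
`AinfWeierstrassKummerIntegral.lean` (brick K1, floor 3 (ω) of the hT₂ programme of crux K★ stmt-BirchSwinnertonDyer-22226,
memo `Summits/…/Cruxes/StarredOptimalManinUnitFiveSeven/Lines/kato-lever-hT2-programme.md` §4 and `…/kato-lever-K1-floor3.md`) —
the version K★'s additive potentially-good cells need (good model over the ramified `𝒪_D`). For a `[p]_W`-division sequence
`u` of `Ŵ(𝔪_{ℂ_F})` whose base point `u₀` admits a `Γ_F`-FIXED lift `Q ∈ Ŵ(𝔫_𝒪)` (`θ_𝒪(Q) = u₀`, `σQ = Q`):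

* §1 `thetaPt : Ŵ(𝔫_𝒪) →+ Ŵ(𝔪_{ℂ_F})`; points killed by `θ_𝒪` read in `Fil¹B_dR⁺` (`kerFil`, Galois, addition = the
  chord–tangent law evaluated `ξ`-adically);
* §2 `logKer z = log_W(ι_𝒪 z)` on `Ŵ(ker θ_𝒪)`: additive (`logKer_add`, `logKerHom`, `logKer_sub`), `Γ_F`-equivariant
  (`gal_logKer`), equal to the ω-period on torsion sequences (`logKer_divisionLiftPt_of_zero`);
* §3 the Kummer integral `z_u := [ũ] − Q ∈ Ŵ(ker θ_𝒪)` (`kummerIntegralPt`), `σ z_u = z_u + [κ_u σ]` (`galPtN_kummerIntegralPt`),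
  `b_ω := logKer z_u ∈ Fil¹` (`bOmega`) and ★ THE COBOUNDARY IDENTITY `σ b_ω − b_ω = ∫_{κ_u σ} ω = omegaPeriodHomO (kummerCocycleO u σ)`
  (`gal_bOmega_sub_bOmega_eq_omegaPeriodHomO`, `exists_gal_sub_eq_omegaPeriodHomO_kummerCocycleO`);
* §4 the supply of fixed lifts for `𝒪_D`-RATIONAL base points: `coeffPt c ∈ Ŵ(𝔫_𝒪)` for `c ∈ 𝔪_D` (`Γ_F` fixes `𝒪_D ⊆ A_inf(𝒪)`,
  `galPtN_coeffPt`), and the corollary `exists_gal_sub_eq_omegaPeriodHomO_of_coeffDisc`.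
Definitions `thetaPt`, `kerFil`, `logKer`, `thetaKer`, `logKerHom`, `kummerIntegralPt`, `bOmega`, `coeffPt`; no named fact, no
`sorry`, no instance. BSD / K★ are not proved by any of this.

References: [FontaineAsterisque223III] Exp. II §1.2, §1.5; [Fontaine1982FormesDifferentielles] §5; [BlochKato1990] Ex. 3.10.1,
(3.11.1); [Kato1993LNM1553] Ch. II Lemma 1.4.3; [SilvermanAEC2009] IV.2.3, IV.5.2, IV.5.5; [CasselsFrohlichANT1967] Ch. VI §3.2.
-/

noncomputable section

open Ideal Filter Topology Field WittVector MvPowerSeries ValuativeRel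

namespace Literature.NumberTheory.PAdicHodge

open Literature.NumberTheory.GaloisRepresentations
open Literature.NumberTheory.GaloisRepresentations.IsNonarchimedeanLocalField
open Literature.NumberTheory.GaloisRepresentations.LubinTate
open Literature.NumberTheory.EllipticCurves

namespace AinfRamTop

variable {F : Type} [Field F] [ValuativeRel F] [TopologicalSpace F] [IsNonarchimedeanLocalField F] [CharZero F]
  {p : ℕ} [Fact p.Prime] [Fact (¬ IsUnit (p : integerC F))] [IsAdicComplete (Ideal.span {(p : integerC F)}) (integerC F)]
  {hp : valuation F p < 1} {D : EisensteinRoot F p hp} {hθ : Function.Surjective (fontaineTheta (integerC F) p)}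
  (W : WeierstrassCurve (EisensteinRoot.CoeffDisc D))

/-! ## §1 `θ_𝒪` on points; points of `Ŵ(𝔫_𝒪)` killed by `θ_𝒪`, read in `Fil¹ B_dR⁺` -/

/-- **`θ_𝒪 : Ŵ(𝔫_𝒪) →+ Ŵ(𝔪_{ℂ_F})`** (`θ_𝒪` is a continuous ring map compatible with the `𝒪_D`-structures).
[cite: CasselsFrohlichANT1967, Ch. VI §3.2] -/
def thetaPt (hθ : Function.Surjective (fontaineTheta (integerC F) p)) : W.Pt (nilTheta D hθ) →+ W.Pt (maxNilIdealC F) :=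
  WeierstrassCurve.Pt.map W (nilTheta D hθ) (maxNilIdealC F) (thetaAlgHom (EisensteinRoot.theta_algebraMap_coeffDisc D))
    continuous_theta fun _ hx => theta_mem_maxNilIdealC hx

/-- Unfolding `thetaPt`. [cite: CasselsFrohlichANT1967, Ch. VI §3.2] -/
@[simp] theorem coe_val_thetaPt (P : W.Pt (nilTheta D hθ)) : ((thetaPt W hθ P).val : CBall F) = theta D (P.val : AinfRamTop D) :=
  rfl

/-- A point of `Ŵ(𝔫_𝒪)` killed by `θ_𝒪` has its coordinate in `ker θ_𝒪 = ω A_inf(𝒪)`. [cite: FarguesFontaine2018, §2.2 (Cor. 2.2.8)] -/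
theorem mem_span_omega_of_thetaPt_eq_zero (z : W.Pt (nilTheta D hθ)) (hz : thetaPt W hθ z = 0) :
    (of D).symm (z.val : AinfRamTop D) ∈ Ideal.span {AinfRam.omega D} := by
  have h1 : theta D (z.val : AinfRamTop D) = 0 := by
    rw [← coe_val_thetaPt, hz, WeierstrassCurve.Pt.val_zero]; rfl
  refine Ideal.mem_span_singleton.2 (AinfRam.omega_dvd_of_theta_eq_zero D ?_)
  have h' := congrArg (fun z : CBall F => (z : CompletedAlgClosure F)) h1
  simp only [ZeroMemClass.coe_zero] at h'
  exact Subtype.ext h'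

/-- `ι_𝒪 z ∈ Fil¹ B_dR⁺` for a point `z` killed by `θ_𝒪`. [cite: FontaineAsterisque223III, Exp. II §1.5.2] -/
theorem toBdR_mem_filOne_of_thetaPt_eq_zero (z : W.Pt (nilTheta D hθ)) (hz : thetaPt W hθ z = 0) :
    BdRPlusTop.of F p (AinfRam.toBdR D hθ ((of D).symm (z.val : AinfRamTop D))) ∈ (BdRPlusTop.filOne F p).toIdeal := by
  have h1 : theta D (z.val : AinfRamTop D) = 0 := by
    rw [← coe_val_thetaPt, hz, WeierstrassCurve.Pt.val_zero]; rfl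
  rw [BdRPlusTop.mem_filOne_iff]
  refine AinfRam.toBdR_mem_span_xiBdR D hθ ?_
  have h' := congrArg (fun z : CBall F => (z : CompletedAlgClosure F)) h1
  simp only [ZeroMemClass.coe_zero] at h'
  exact Subtype.ext h'

/-- **A point `z ∈ Ŵ(𝔫_𝒪)` with `θ_𝒪(z) = 0`, read in `Fil¹ B_dR⁺ = (ξ_dR)`.** [cite: FontaineAsterisque223III, Exp. II §1.5.2] -/
def kerFil (z : W.Pt (nilTheta D hθ)) (hz : thetaPt W hθ z = 0) : (BdRPlusTop.filOne F p).toIdeal :=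
  ⟨BdRPlusTop.of F p (AinfRam.toBdR D hθ ((of D).symm (z.val : AinfRamTop D))), toBdR_mem_filOne_of_thetaPt_eq_zero W z hz⟩

/-- Unfolding `kerFil`. [cite: FontaineAsterisque223III, Exp. II §1.5.2] -/
@[simp] theorem coe_kerFil (z : W.Pt (nilTheta D hθ)) (hz : thetaPt W hθ z = 0) :
    (kerFil W z hz : BdRPlusTop F p) = BdRPlusTop.of F p (AinfRam.toBdR D hθ ((of D).symm (z.val : AinfRamTop D))) := rfl

/-- `kerFil` respects equality of points (and ignores the proof). [cite: FontaineAsterisque223III, Exp. II §1.5.2] -/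
theorem kerFil_congr {z z' : W.Pt (nilTheta D hθ)} (h : z = z') (hz : thetaPt W hθ z = 0) (hz' : thetaPt W hθ z' = 0) :
    kerFil W z hz = kerFil W z' hz' := by subst h; rfl

/-- **`θ_𝒪([ũ]) = u₀` as points.** [cite: FontaineAsterisque223III, Exp. II §1.2.2] -/
theorem thetaPt_divisionLiftPt (u : ℕ → (maxNilIdealC F).toIdeal) (hup : ∀ n, mulPC W (u (n + 1)) = u n) :
    thetaPt W hθ (divisionLiftPt W hθ u hup) = ⟨u 0⟩ :=
  WeierstrassCurve.Pt.ext (Subtype.ext (by rw [coe_val_thetaPt, theta_divisionLiftPt]))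

/-- `θ_𝒪[t] = 0` as a point, for a torsion sequence `t` (`t₀ = 0`). [cite: FontaineAsterisque223III, Exp. II §1.2.2] -/
theorem thetaPt_divisionLiftPt_of_zero {t : ℕ → (maxNilIdealC F).toIdeal} (ht0 : (t 0 : CBall F) = 0)
    (htp : ∀ n, mulPC W (t (n + 1)) = t n) : thetaPt W hθ (divisionLiftPt W hθ t htp) = 0 := by
  rw [thetaPt_divisionLiftPt]
  exact WeierstrassCurve.Pt.ext (Subtype.ext ht0)

/-- For a torsion sequence, `kerFil [t]` is the tree's `torsionLiftFil`. [cite: FontaineAsterisque223III, Exp. II §1.5.2] -/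
theorem kerFil_divisionLiftPt_of_zero {t : ℕ → (maxNilIdealC F).toIdeal} (ht0 : (t 0 : CBall F) = 0)
    (htp : ∀ n, mulPC W (t (n + 1)) = t n) (h : thetaPt W hθ (divisionLiftPt W hθ t htp) = 0) :
    kerFil W (divisionLiftPt W hθ t htp) h = torsionLiftFil W hθ t ht0 htp := rfl

/-- `θ_𝒪(σ z) = 0` when `θ_𝒪(z) = 0` (`θ_𝒪 ∘ σ = σ ∘ θ_𝒪`). [cite: FontaineAsterisque223III, Exp. II §1.2] -/
theorem thetaPt_galPtN_eq_zero (σ : absoluteGaloisGroup F) {z : W.Pt (nilTheta D hθ)} (hz : thetaPt W hθ z = 0) :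
    thetaPt W hθ (galPtN W hθ σ z) = 0 := by
  have h1 : ((theta D (z.val : AinfRamTop D) : CBall F) : CompletedAlgClosure F) = 0 := by
    rw [← coe_val_thetaPt, hz, WeierstrassCurve.Pt.val_zero]; rfl
  refine WeierstrassCurve.Pt.ext (Subtype.ext (Subtype.ext ?_))
  rw [coe_val_thetaPt, coe_val_galPtN, coe_theta_gal, h1, smul_zero, WeierstrassCurve.Pt.val_zero]
  rfl

/-- **`Γ_F`-equivariance**: `σ(ι_𝒪 z) = ι_𝒪(σ z)` in `Fil¹B_dR⁺`. [cite: FontaineAsterisque223III, Exp. II §1.5] -/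
theorem gal_coe_kerFil (σ : absoluteGaloisGroup F) (z : W.Pt (nilTheta D hθ)) (hz : thetaPt W hθ z = 0) :
    BdRPlusTop.gal F p σ (kerFil W z hz : BdRPlusTop F p) =
      (kerFil W (galPtN W hθ σ z) (thetaPt_galPtN_eq_zero W σ hz) : BdRPlusTop F p) := by
  rw [coe_kerFil, coe_kerFil, BdRPlusTop.gal_of, AinfRam.galBdRPlus_toBdR, coe_val_galPtN]
  rfl

/-- `θ_𝒪(z + z') = 0` when `θ_𝒪 z = θ_𝒪 z' = 0`. [cite: CasselsFrohlichANT1967, Ch. VI §3.2] -/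
theorem thetaPt_add_eq_zero {z z' : W.Pt (nilTheta D hθ)} (hz : thetaPt W hθ z = 0) (hz' : thetaPt W hθ z' = 0) :
    thetaPt W hθ (z + z') = 0 := by
  rw [map_add, hz, hz', add_zero]

/-- **Addition read in `Fil¹`**: `ι_𝒪(z + z') = F_Wᶠ(ι_𝒪 z, ι_𝒪 z')`, the chord–tangent law over `𝒪_D` (base-changed to the
coefficient field) evaluated `ξ`-adically in `B_dR⁺`. [cite: FontaineAsterisque223III, Exp. II §1.5.2] -/
theorem coe_kerFil_add (z z' : W.Pt (nilTheta D hθ)) (hz : thetaPt W hθ z = 0) (hz' : thetaPt W hθ z' = 0)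
    (h : thetaPt W hθ (z + z') = 0) :
    (kerFil W (z + z') h : BdRPlusTop F p) =
      (evalPt (BdRPlusTop.filOne F p) (MvPowerSeries.map (EisensteinRoot.CoeffDisc.toFieldCoeff D hθ) W.formalGroupLaw)
        (AinfRamXiTop.constantCoeff_map_eq_zero _ W.constantCoeff_formalGroupLaw) ![kerFil W z hz, kerFil W z' hz'] :
        BdRPlusTop F p) := by
  rw [coe_kerFil, val_add_N, addW]
  exact AinfRamXiTop.toBdR_evalPt_of_symm W.formalGroupLaw W.constantCoeff_formalGroupLaw _ _
    (fun i => by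
      fin_cases i
      · exact mem_span_omega_of_thetaPt_eq_zero W z hz
      · exact mem_span_omega_of_thetaPt_eq_zero W z' hz')
    _ (fun i => by fin_cases i <;> rfl)

/-! ## §2 `log_W` on `Ŵ(ker θ_𝒪)` -/

/-- **`log_W(F_Wᶠ(x, y)) = log_W(x) + log_W(y)` on `Fil¹B_dR⁺`** for `W` over `𝒪_D` (AEC IV.5.2 over the coefficient field,
evaluated `ξ`-adically). [cite: SilvermanAEC2009, IV.5.2] [cite: FontaineAsterisque223III, Exp. II §1.5.4] -/
theorem log_evalPt_formalGroupLaw (x y : (BdRPlusTop.filOne F p).toIdeal) :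
    (evalPt₁ (BdRPlusTop.filOne F p) (logSeries hθ W) (constantCoeff_logSeries W)
        (evalPt (BdRPlusTop.filOne F p) (MvPowerSeries.map (EisensteinRoot.CoeffDisc.toFieldCoeff D hθ) W.formalGroupLaw)
          (AinfRamXiTop.constantCoeff_map_eq_zero _ W.constantCoeff_formalGroupLaw) ![x, y]) : BdRPlusTop F p) =
      evalPt₁ (BdRPlusTop.filOne F p) (logSeries hθ W) (constantCoeff_logSeries W) x +
        evalPt₁ (BdRPlusTop.filOne F p) (logSeries hθ W) (constantCoeff_logSeries W) y := by
  set V := W.map (EisensteinRoot.CoeffDisc.toFieldCoeff D hθ) with hV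
  have hFq : (MvPowerSeries.map (EisensteinRoot.CoeffDisc.toFieldCoeff D hθ) W.formalGroupLaw).constantCoeff = 0 :=
    AinfRamXiTop.constantCoeff_map_eq_zero _ W.constantCoeff_formalGroupLaw
  -- the point `Fᶠ(x, y)` of `Fil¹` is `F_V(x, y)`
  have hpt : evalPt (BdRPlusTop.filOne F p) (MvPowerSeries.map (EisensteinRoot.CoeffDisc.toFieldCoeff D hθ) W.formalGroupLaw)
        hFq ![x, y] = evalPt (BdRPlusTop.filOne F p) V.formalGroupLaw V.constantCoeff_formalGroupLaw ![x, y] := by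
    apply Subtype.ext
    exact congrArg Subtype.val (evalPt_congr (BdRPlusTop.filOne F p) (map_formalGroupLaw_fieldCoeff W) hFq
      V.constantCoeff_formalGroupLaw ![x, y])
  have hlog0 : PowerSeries.constantCoeff V.formalLog = 0 := V.constantCoeff_formalLog
  have hsub0 : (V.formalLog.subst V.formalGroupLaw).constantCoeff = 0 :=
    constantCoeff_subst_zero (σ := Unit) (fun _ => V.constantCoeff_formalGroupLaw) hlog0
  have hX0 : ∀ i : Fin 2, (V.formalLog.subst (MvPowerSeries.X i : MvPowerSeries (Fin 2) (FieldCoeff hp hθ))).constantCoeff = 0 :=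
    fun i => constantCoeff_subst_zero (σ := Unit) (fun _ => MvPowerSeries.constantCoeff_X i) hlog0
  have hsum0 : (V.formalLog.subst (MvPowerSeries.X 0 : MvPowerSeries (Fin 2) (FieldCoeff hp hθ)) +
      V.formalLog.subst (MvPowerSeries.X 1 : MvPowerSeries (Fin 2) (FieldCoeff hp hθ))).constantCoeff = 0 := by
    rw [map_add, hX0 0, hX0 1, add_zero]
  rw [hpt]
  have hl : ∀ (z : (BdRPlusTop.filOne F p).toIdeal),
      (evalPt₁ (BdRPlusTop.filOne F p) (logSeries hθ W) (constantCoeff_logSeries W) z : BdRPlusTop F p) =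
        evalPt₁ (BdRPlusTop.filOne F p) V.formalLog hlog0 z := fun z =>
    congrArg Subtype.val (evalPt_congr (BdRPlusTop.filOne F p) (ι := Unit) (logSeries_eq_formalLog W)
      (constantCoeff_logSeries W) hlog0 fun _ => z)
  rw [hl, hl, hl, ← evalPt₁_subst (BdRPlusTop.filOne F p) V.formalGroupLaw V.constantCoeff_formalGroupLaw V.formalLog hlog0 hsub0,
    evalPt_congr (BdRPlusTop.filOne F p) V.formalLog_subst_formalGroupLaw hsub0 hsum0 ![x, y], coe_evalPt, map_add,
    ← coe_evalPt (BdRPlusTop.filOne F p) _ (hX0 0), ← coe_evalPt (BdRPlusTop.filOne F p) _ (hX0 1),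
    evalPt₁_subst (BdRPlusTop.filOne F p) (MvPowerSeries.X 0 : MvPowerSeries (Fin 2) (FieldCoeff hp hθ))
      (MvPowerSeries.constantCoeff_X 0) V.formalLog hlog0 (hX0 0),
    evalPt₁_subst (BdRPlusTop.filOne F p) (MvPowerSeries.X 1 : MvPowerSeries (Fin 2) (FieldCoeff hp hθ))
      (MvPowerSeries.constantCoeff_X 1) V.formalLog hlog0 (hX0 1), evalPt_X, evalPt_X]
  rfl

/-- **`log_W(ι_𝒪 z) ∈ B_dR⁺(F)`** for a point `z ∈ Ŵ(𝔫_𝒪)` with `θ_𝒪(z) = 0`: the formal logarithm evaluated `ξ`-adically at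
`ι_𝒪 z ∈ Fil¹`. [cite: Fontaine1982FormesDifferentielles, §5] [cite: SilvermanAEC2009, IV.5.5] -/
def logKer (z : W.Pt (nilTheta D hθ)) (hz : thetaPt W hθ z = 0) : BdRPlusTop F p :=
  (evalPt₁ (BdRPlusTop.filOne F p) (logSeries hθ W) (constantCoeff_logSeries W) (kerFil W z hz) : BdRPlusTop F p)

/-- `logKer` respects equality of points (and ignores the proof). [cite: Fontaine1982FormesDifferentielles, §5] -/
theorem logKer_congr {z z' : W.Pt (nilTheta D hθ)} (h : z = z') (hz : thetaPt W hθ z = 0) (hz' : thetaPt W hθ z' = 0) :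
    logKer W z hz = logKer W z' hz' := by subst h; rfl

/-- `log_W(ι_𝒪 z) ∈ Fil¹ B_dR⁺`. [cite: Fontaine1982FormesDifferentielles, §5] -/
theorem logKer_mem_filOne (z : W.Pt (nilTheta D hθ)) (hz : thetaPt W hθ z = 0) :
    logKer W z hz ∈ (BdRPlusTop.filOne F p).toIdeal :=
  (evalPt₁ (BdRPlusTop.filOne F p) (logSeries hθ W) (constantCoeff_logSeries W) (kerFil W z hz)).2

/-- **`logKer [t] = ∫_t ω`** for a torsion sequence `t`: on torsion sequences `logKer` IS the ω-period.
[cite: Fontaine1982FormesDifferentielles, §5] -/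
theorem logKer_divisionLiftPt_of_zero {t : ℕ → (maxNilIdealC F).toIdeal} (ht0 : (t 0 : CBall F) = 0)
    (htp : ∀ n, mulPC W (t (n + 1)) = t n) (h : thetaPt W hθ (divisionLiftPt W hθ t htp) = 0) :
    logKer W (divisionLiftPt W hθ t htp) h = omegaPeriod W hθ t ht0 htp := rfl

/-- **`Γ_F`-equivariance: `σ(log_W(ι_𝒪 z)) = log_W(ι_𝒪(σ z))`.** [cite: FontaineAsterisque223III, Exp. II §1.5.4] -/
theorem gal_logKer (σ : absoluteGaloisGroup F) (z : W.Pt (nilTheta D hθ)) (hz : thetaPt W hθ z = 0) :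
    BdRPlusTop.gal F p σ (logKer W z hz) = logKer W (galPtN W hθ σ z) (thetaPt_galPtN_eq_zero W σ hz) := by
  rw [logKer, logKer, FieldCoeff.gal_evalPt₁]
  congr 2
  exact Subtype.ext (gal_coe_kerFil W σ z hz)

/-- **Additivity: `log_W(ι_𝒪(z + z')) = log_W(ι_𝒪 z) + log_W(ι_𝒪 z')`** on `Ŵ(ker θ_𝒪)`. [cite: SilvermanAEC2009, IV.5.2]
[cite: Fontaine1982FormesDifferentielles, §5] -/
theorem logKer_add (z z' : W.Pt (nilTheta D hθ)) (hz : thetaPt W hθ z = 0) (hz' : thetaPt W hθ z' = 0)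
    (h : thetaPt W hθ (z + z') = 0) : logKer W (z + z') h = logKer W z hz + logKer W z' hz' := by
  have hk : kerFil W (z + z') h =
      evalPt (BdRPlusTop.filOne F p) (MvPowerSeries.map (EisensteinRoot.CoeffDisc.toFieldCoeff D hθ) W.formalGroupLaw)
        (AinfRamXiTop.constantCoeff_map_eq_zero _ W.constantCoeff_formalGroupLaw) ![kerFil W z hz, kerFil W z' hz'] :=
    Subtype.ext (coe_kerFil_add W z z' hz hz' h)
  rw [logKer, hk, log_evalPt_formalGroupLaw]
  rfl

/-- **The subgroup `Ŵ(ker θ_𝒪) = ker(θ_𝒪 : Ŵ(𝔫_𝒪) → Ŵ(𝔪_{ℂ_F}))`.** [cite: FontaineAsterisque223III, Exp. II §1.2.2] -/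
def thetaKer (hθ : Function.Surjective (fontaineTheta (integerC F) p)) : AddSubgroup (W.Pt (nilTheta D hθ)) :=
  (thetaPt W hθ).ker

/-- Membership in `thetaKer`. [cite: FontaineAsterisque223III, Exp. II §1.2.2] -/
theorem mem_thetaKer_iff {z : W.Pt (nilTheta D hθ)} : z ∈ thetaKer W hθ ↔ thetaPt W hθ z = 0 := (thetaPt W hθ).mem_ker

/-- **`log_W ∘ ι_𝒪 : Ŵ(ker θ_𝒪) →+ B_dR⁺(F)` as a group homomorphism.** [cite: Fontaine1982FormesDifferentielles, §5] -/
def logKerHom (hθ : Function.Surjective (fontaineTheta (integerC F) p)) : thetaKer W hθ →+ BdRPlusTop F p :=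
  AddMonoidHom.mk' (fun z => logKer W z.1 ((mem_thetaKer_iff W).1 z.2)) fun z z' =>
    logKer_add W z.1 z'.1 ((mem_thetaKer_iff W).1 z.2) ((mem_thetaKer_iff W).1 z'.2) _

/-- Unfolding `logKerHom`. [cite: Fontaine1982FormesDifferentielles, §5] -/
theorem logKerHom_apply (z : thetaKer W hθ) : logKerHom W hθ z = logKer W z.1 ((mem_thetaKer_iff W).1 z.2) := rfl

/-- `log_W(ι_𝒪 0) = 0`. [cite: SilvermanAEC2009, IV.5.5] -/
theorem logKer_zero (h : thetaPt W hθ (0 : W.Pt (nilTheta D hθ)) = 0) : logKer W 0 h = 0 := by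
  have h2 := logKer_add W 0 0 h h (by rw [add_zero]; exact h)
  have e : logKer W (0 + 0) (by rw [add_zero]; exact h) = logKer W 0 h := logKer_congr W (add_zero 0) _ _
  rw [e] at h2
  exact left_eq_add.mp h2

/-- `log_W(ι_𝒪(z − z')) = log_W(ι_𝒪 z) − log_W(ι_𝒪 z')`. [cite: SilvermanAEC2009, IV.5.2] -/
theorem logKer_sub (z z' : W.Pt (nilTheta D hθ)) (hz : thetaPt W hθ z = 0) (hz' : thetaPt W hθ z' = 0)
    (h : thetaPt W hθ (z - z') = 0) : logKer W (z - z') h = logKer W z hz - logKer W z' hz' := by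
  have e := map_sub (logKerHom W hθ) ⟨z, (mem_thetaKer_iff W).2 hz⟩ ⟨z', (mem_thetaKer_iff W).2 hz'⟩
  rw [logKerHom_apply, logKerHom_apply, logKerHom_apply] at e
  exact (logKer_congr W rfl _ _).trans e

/-! ## §3 The Kummer integral of a division sequence with a `Γ_F`-fixed lift of its base point -/

section Kummer

variable (ψ : EisensteinRoot.CoeffDisc D →+* LTCoeff F) {hψ : ∀ c, algebraMap (LTCoeff F) F (ψ c) = EisensteinRoot.CoeffDisc.toF D c}
  {u : ℕ → (maxNilIdealC F).toIdeal} (hup : ∀ n, mulPC W (u (n + 1)) = u n) {Q : W.Pt (nilTheta D hθ)}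

/-- **Rationality of the base point from a fixed lift**: if `Q ∈ Ŵ(𝔫_𝒪)` is `Γ_F`-fixed with `θ_𝒪(Q) = u₀`, then `σ u₀ = u₀`
for all `σ ∈ Γ_F`. [cite: FontaineAsterisque223III, Exp. II §1.2] -/
theorem galCBall_base_eq_of_fixedLift (hQ : thetaPt W hθ Q = ⟨u 0⟩) (hQσ : ∀ σ : absoluteGaloisGroup F, galPtN W hθ σ Q = Q)
    (σ : absoluteGaloisGroup F) : galCBall σ (u 0 : CBall F) = u 0 := by
  have hval : theta D ((Q.val : AinfRamTop D)) = u 0 := by rw [← coe_val_thetaPt, hQ]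
  have hσ : gal D σ (Q.val : AinfRamTop D) = Q.val := by rw [← coe_val_galPtN, hQσ σ]
  apply Subtype.ext
  rw [coe_galCBall, ← hval, ← coe_theta_gal, hσ]

/-- **The Kummer integral `z_u := [ũ] − Q ∈ Ŵ(𝔫_𝒪)`** of the division sequence `u` relative to the lift `Q` of its base point.
[cite: FontaineAsterisque223III, Exp. II §1.2.2] [cite: BlochKato1990, Ex. 3.10.1] -/
def kummerIntegralPt (hup : ∀ n, mulPC W (u (n + 1)) = u n) (Q : W.Pt (nilTheta D hθ)) : W.Pt (nilTheta D hθ) :=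
  divisionLiftPt W hθ u hup - Q

/-- Unfolding `kummerIntegralPt`. [cite: FontaineAsterisque223III, Exp. II §1.2.2] -/
theorem kummerIntegralPt_def (Q : W.Pt (nilTheta D hθ)) : kummerIntegralPt W hup Q = divisionLiftPt W hθ u hup - Q := rfl

/-- **`θ_𝒪(z_u) = 0`**: `θ_𝒪[ũ] = u₀ = θ_𝒪(Q)`. [cite: FontaineAsterisque223III, Exp. II §1.2.2] -/
theorem thetaPt_kummerIntegralPt (hQ : thetaPt W hθ Q = ⟨u 0⟩) : thetaPt W hθ (kummerIntegralPt W hup Q) = 0 := by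
  rw [kummerIntegralPt, map_sub, thetaPt_divisionLiftPt, hQ, sub_self]

/-- **`σ(z_u) = z_u + [κ_u(σ)]`** in `Ŵ(𝔫_𝒪)` (`Q` is fixed and `(σ − 1)[ũ] = [κ_u σ]`). [cite: FontaineAsterisque223III, Exp. II §1.2.2]
[cite: BlochKato1990, Ex. 3.10.1] -/
theorem galPtN_kummerIntegralPt (hQσ : ∀ σ : absoluteGaloisGroup F, galPtN W hθ σ Q = Q) (σ : absoluteGaloisGroup F) :
    galPtN W hθ σ (kummerIntegralPt W hup Q) =
      kummerIntegralPt W hup Q + divisionLiftPt W hθ (kummerSeqO W ψ σ u) (mulPC_kummerSeqO W ψ (hψ := hψ) σ hup) := by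
  rw [kummerIntegralPt, map_sub, hQσ, divisionLiftPt_kummerSeqO W ψ σ hup hψ]
  abel

/-- `θ_𝒪[κ_u(σ)] = 0` as a point (the Kummer torsion sequence starts at `0` when `u₀` is rational). [cite: BlochKato1990, Ex. 3.10.1] -/
theorem thetaPt_divisionLiftPt_kummerSeqO (hQ : thetaPt W hθ Q = ⟨u 0⟩)
    (hQσ : ∀ σ : absoluteGaloisGroup F, galPtN W hθ σ Q = Q) (σ : absoluteGaloisGroup F) :
    thetaPt W hθ (divisionLiftPt W hθ (kummerSeqO W ψ σ u) (mulPC_kummerSeqO W ψ (hψ := hψ) σ hup)) = 0 :=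
  thetaPt_divisionLiftPt_of_zero W (coe_kummerSeqO_zero W ψ σ (galCBall_base_eq_of_fixedLift W hQ hQσ σ)) _

/-- **The ω-integrating element `b_ω := log_W(ι_𝒪 z_u) ∈ B_dR⁺(F)`** of the Kummer cocycle of `u`.
[cite: BlochKato1990, Ex. 3.10.1] [cite: Kato1993LNM1553, Ch. II Lemma 1.4.3] -/
def bOmega (hup : ∀ n, mulPC W (u (n + 1)) = u n) (hQ : thetaPt W hθ Q = ⟨u 0⟩) : BdRPlusTop F p :=
  logKer W (kummerIntegralPt W hup Q) (thetaPt_kummerIntegralPt W hup hQ)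

/-- `b_ω ∈ Fil¹ B_dR⁺`. [cite: Fontaine1982FormesDifferentielles, §5] -/
theorem bOmega_mem_filOne (hQ : thetaPt W hθ Q = ⟨u 0⟩) : bOmega W hup hQ ∈ (BdRPlusTop.filOne F p).toIdeal :=
  logKer_mem_filOne W _ _

/-- **THE COBOUNDARY IDENTITY `σ(b_ω) − b_ω = ∫_{κ_u(σ)} ω`** (sequence form). [cite: BlochKato1990, Ex. 3.10.1]
[cite: Kato1993LNM1553, Ch. II Lemma 1.4.3] [cite: FontaineAsterisque223III, Exp. II §1.5.4] -/
theorem gal_bOmega_sub_bOmega (hQ : thetaPt W hθ Q = ⟨u 0⟩) (hQσ : ∀ σ : absoluteGaloisGroup F, galPtN W hθ σ Q = Q)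
    (σ : absoluteGaloisGroup F) :
    BdRPlusTop.gal F p σ (bOmega W hup hQ) - bOmega W hup hQ =
      omegaPeriod W hθ (kummerSeqO W ψ σ u) (coe_kummerSeqO_zero W ψ σ (galCBall_base_eq_of_fixedLift W hQ hQσ σ))
        (mulPC_kummerSeqO W ψ (hψ := hψ) σ hup) := by
  rw [bOmega, gal_logKer, logKer_congr W (galPtN_kummerIntegralPt W ψ (hψ := hψ) hup hQσ σ) _
      (thetaPt_add_eq_zero W (thetaPt_kummerIntegralPt W hup hQ) (thetaPt_divisionLiftPt_kummerSeqO W ψ (hψ := hψ) hup hQ hQσ σ)),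
    logKer_add W _ _ (thetaPt_kummerIntegralPt W hup hQ) (thetaPt_divisionLiftPt_kummerSeqO W ψ (hψ := hψ) hup hQ hQσ σ),
    add_sub_cancel_left]
  rfl

/-- **THE COBOUNDARY IDENTITY, Tate-module form: `σ(b_ω) − b_ω = ∫_{κ_u(σ)} ω = omegaPeriodHomO (kummerCocycleO u σ)`.**
[cite: BlochKato1990, Ex. 3.10.1] [cite: Kato1993LNM1553, Ch. II Lemma 1.4.3] -/
theorem gal_bOmega_sub_bOmega_eq_omegaPeriodHomO (hQ : thetaPt W hθ Q = ⟨u 0⟩)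
    (hQσ : ∀ σ : absoluteGaloisGroup F, galPtN W hθ σ Q = Q) (σ : absoluteGaloisGroup F) :
    BdRPlusTop.gal F p σ (bOmega W hup hQ) - bOmega W hup hQ =
      omegaPeriodHomO W ψ hθ hψ (kummerCocycleO W ψ hψ u hup (galCBall_base_eq_of_fixedLift W hQ hQσ) σ) := by
  rw [gal_bOmega_sub_bOmega W ψ (hψ := hψ) hup hQ hQσ σ, omegaPeriodHomO_apply']
  exact omegaPeriod_congr_seq W (seqO_kummerCocycleO W ψ (hψ := hψ) (hup := hup)
    (hu₀ := galCBall_base_eq_of_fixedLift W hQ hQσ) σ).symm _ _ _ _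

/-- **Brick K1 over the ramified base, floor 3 (ω): the Kummer cocycle of a division sequence with a `Γ_F`-fixed lift of its
base point has an ω-integrating element in `Fil¹B_dR⁺(F)`.** [cite: BlochKato1990, Ex. 3.10.1, (3.11.1)]
[cite: Kato1993LNM1553, Ch. II Lemma 1.4.3] -/
theorem exists_gal_sub_eq_omegaPeriodHomO_kummerCocycleO (hQ : thetaPt W hθ Q = ⟨u 0⟩)
    (hQσ : ∀ σ : absoluteGaloisGroup F, galPtN W hθ σ Q = Q) :
    ∃ b : BdRPlusTop F p, b ∈ (BdRPlusTop.filOne F p).toIdeal ∧ ∀ σ : absoluteGaloisGroup F,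
      BdRPlusTop.gal F p σ b - b =
        omegaPeriodHomO W ψ hθ hψ (kummerCocycleO W ψ hψ u hup (galCBall_base_eq_of_fixedLift W hQ hQσ) σ) :=
  ⟨bOmega W hup hQ, bOmega_mem_filOne W hup hQ, gal_bOmega_sub_bOmega_eq_omegaPeriodHomO W ψ hup hQ hQσ⟩

end Kummer

/-! ## §4 Fixed lifts of `𝒪_D`-rational base points: `𝔪_D ⊂ 𝔫_𝒪` -/

/-- `c ∈ 𝒪_D` with `|c| < 1` lies in `𝔫_𝒪` (`θ_𝒪(c · 1) = c`). [cite: FontaineAsterisque223III, Exp. II §1.2.2] -/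
theorem algebraMap_mem_nilTheta (c : EisensteinRoot.CoeffDisc D)
    (hc : ‖algebraMap F (CompletedAlgClosure F) (EisensteinRoot.CoeffDisc.toF D c)‖ < 1) :
    algebraMap (EisensteinRoot.CoeffDisc D) (AinfRamTop D) c ∈ (nilTheta D hθ).toIdeal := by
  obtain ⟨x, rfl⟩ := (EisensteinRoot.CoeffDisc.of D).surjective c
  rw [mem_nilTheta_iff, EisensteinRoot.theta_algebraMap_coeffDisc, EisensteinRoot.coe_algebraMap_coeffDisc_cBall]
  exact hc

/-- **The constant point `P_c ∈ Ŵ(𝔫_𝒪)` with coordinate `c ∈ 𝔪_D`** — a lift of the `𝒪_D`-rational point of `Ŵ(𝔪_D)` with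
parameter `c`. [cite: FontaineAsterisque223III, Exp. II §1.2.2] -/
def coeffPt (hθ : Function.Surjective (fontaineTheta (integerC F) p)) (c : EisensteinRoot.CoeffDisc D)
    (hc : ‖algebraMap F (CompletedAlgClosure F) (EisensteinRoot.CoeffDisc.toF D c)‖ < 1) : W.Pt (nilTheta D hθ) :=
  ⟨⟨algebraMap (EisensteinRoot.CoeffDisc D) (AinfRamTop D) c, algebraMap_mem_nilTheta c hc⟩⟩

/-- Unfolding `coeffPt`. [cite: FontaineAsterisque223III, Exp. II §1.2.2] -/
@[simp] theorem coe_val_coeffPt (c : EisensteinRoot.CoeffDisc D)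
    (hc : ‖algebraMap F (CompletedAlgClosure F) (EisensteinRoot.CoeffDisc.toF D c)‖ < 1) :
    ((coeffPt W hθ c hc).val : AinfRamTop D) = algebraMap (EisensteinRoot.CoeffDisc D) (AinfRamTop D) c := rfl

/-- **`Γ_F` fixes `P_c`** (`Γ_F` fixes `𝒪_D ⊆ A_inf(𝒪)`). [cite: FontaineAsterisque223III, Exp. II §1.2] -/
theorem galPtN_coeffPt (σ : absoluteGaloisGroup F) (c : EisensteinRoot.CoeffDisc D)
    (hc : ‖algebraMap F (CompletedAlgClosure F) (EisensteinRoot.CoeffDisc.toF D c)‖ < 1) :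
    galPtN W hθ σ (coeffPt W hθ c hc) = coeffPt W hθ c hc :=
  WeierstrassCurve.Pt.ext (Subtype.ext (by rw [coe_val_galPtN, coe_val_coeffPt, EisensteinRoot.gal_algebraMap_coeffDisc]))

/-- **`θ_𝒪(P_c) = c`.** [cite: FontaineAsterisque223III, Exp. II §1.2.2] -/
theorem coe_val_thetaPt_coeffPt (c : EisensteinRoot.CoeffDisc D)
    (hc : ‖algebraMap F (CompletedAlgClosure F) (EisensteinRoot.CoeffDisc.toF D c)‖ < 1) :
    ((thetaPt W hθ (coeffPt W hθ c hc)).val : CBall F) = algebraMap (EisensteinRoot.CoeffDisc D) (CBall F) c := by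
  rw [coe_val_thetaPt, coe_val_coeffPt, EisensteinRoot.theta_algebraMap_coeffDisc]

/-- **Brick K1 over the ramified base, floor 3 (ω), for `𝒪_D`-rational base points**: a `[p]_W`-division sequence `u` in
`Ŵ(𝔪_{ℂ_F})` whose base point `u₀` is the `𝒪_D`-rational point with parameter `c ∈ 𝔪_D` has an ω-integrating element
`b ∈ Fil¹B_dR⁺(F)`: `σ b − b = ∫_{κ_u(σ)} ω` for all `σ ∈ Γ_F`. [cite: BlochKato1990, Ex. 3.10.1, (3.11.1)] [cite: Kato1993LNM1553, Ch. II Lemma 1.4.3] -/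
theorem exists_gal_sub_eq_omegaPeriodHomO_of_coeffDisc (ψ : EisensteinRoot.CoeffDisc D →+* LTCoeff F)
    {hψ : ∀ c, algebraMap (LTCoeff F) F (ψ c) = EisensteinRoot.CoeffDisc.toF D c}
    {u : ℕ → (maxNilIdealC F).toIdeal} (hup : ∀ n, mulPC W (u (n + 1)) = u n) (c : EisensteinRoot.CoeffDisc D)
    (hc : ‖algebraMap F (CompletedAlgClosure F) (EisensteinRoot.CoeffDisc.toF D c)‖ < 1)
    (hu0 : (u 0 : CBall F) = algebraMap (EisensteinRoot.CoeffDisc D) (CBall F) c) :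
    ∃ hu₀ : ∀ σ : absoluteGaloisGroup F, galCBall σ (u 0 : CBall F) = u 0,
      ∃ b : BdRPlusTop F p, b ∈ (BdRPlusTop.filOne F p).toIdeal ∧ ∀ σ : absoluteGaloisGroup F,
        BdRPlusTop.gal F p σ b - b = omegaPeriodHomO W ψ hθ hψ (kummerCocycleO W ψ hψ u hup hu₀ σ) := by
  have hQ : thetaPt W hθ (coeffPt W hθ c hc) = ⟨u 0⟩ :=
    WeierstrassCurve.Pt.ext (Subtype.ext (by rw [coe_val_thetaPt_coeffPt, hu0]))
  exact ⟨galCBall_base_eq_of_fixedLift W hQ fun σ => galPtN_coeffPt W σ c hc,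
    exists_gal_sub_eq_omegaPeriodHomO_kummerCocycleO W ψ hup hQ fun σ => galPtN_coeffPt W σ c hc⟩

end AinfRamTop

end Literature.NumberTheory.PAdicHodge

end
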